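import Summits.BirchSwinnertonDyer.Rank1Residual.Additive.QuadraticBranchPeriodRatioOfNamedFact
import Literature.NumberTheory.EllipticCurves.SkinnerUrban2014.PAdicUnitImaginaryPeriodRatioProofs
import HarnessLib

/-!
# The period-ratio binder `hper` of the quadratic-branch chain at EVERY odd `p ≥ 5` — both parities —
# from ONE named fact with a printed proof, Mazur's `p ∤ c₀` (Invent. Math. 44 (1978) Cor. 4.1,
# `mazur_not_dvd_maninConstant_of_odd`), and the pair-level consumers with NO analytic datum and NO
# parity hypothesis (cell `b2b-bsdres`, lane CLASS-CLOSURE §3.14, seat x1b GEN 45, file 130;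
# bookkeeping over the tree's theorems; nothing asserted, nothing booked)

HONEST FRAMING (cell `b2b-bsdres`, run/shared/lean/b2b/bsd-rank1-residual/, verbatim in every
file): the goal of the cell is to DELETE the COMBINATION-SHAPED residual classes of the
Birch–Swinnerton-Dyer formula for ALL analytic-rank `≤ 1` elliptic curves over `ℚ` — "full BSD
formula for every rank `≤ 1` curve in class `C`" assembled STRICTLY from published theorems — so
that the rank-`≤ 1` remainder becomes exactly the CONSTRUCTION-SHAPED classes, which are TYPED
(missing-input `Prop`s), NOT attempted. This is not "finishing BSD". Research route; NO CLAIM BEYOND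
STATED CLASSES; the classes served (O10-PS = X12 ∩ CM-inert ∩ Kodaira `I₀*`; O5a / O7-ss ∩ `e = 2`)
stay CONSTRUCTION-SHAPED and OPEN; nothing here changes a label or a mark; census / instrument output
is EVIDENCE, never a Literature fact. THEOREMS ONLY (0 definitions, 0 named facts minted, 0 `sorry`):
every conclusion is CONDITIONAL on its displayed hypotheses — the typed `@[conjecture]` items (C1_η)
and C-cc-1 appear ONLY as hypotheses; the named fact `mazur_not_dvd_maninConstant_of_odd`
(`ManinConstantSemistablePrimewise.lean`, Mazur 1978 Cor. 4.1 in lattice form; PRINTED PROOF, not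
formalised) is TAKEN AS A HYPOTHESIS `hM` (conditional result), never asserted.

PARTITION (D-0054): CornerF inert-bad sub-cell (B12 / O10; O10-PS `e = 2`) and EXCLUDED-DOMAIN
non-CM additive `p` with a good `a_p = 0` `p*`-twin (O5a / O7-ss ∩ `e = 2`) × ALL rank-one pairs of
those families × `p ≥ 5` — types-the-object-of / none: removes the displayed period-ratio binder
`hper` at EVERY odd `p ≥ 5` (file 129 did `p ≡ 1 (mod 4)`) modulo one existing named fact; closes no
cell, books nothing, moves no mark.

## What (x1b GEN 45, file 130)

File 129 (`QuadraticBranchPeriodRatioOfNamedFact`) discharged `hper` at `p ≡ 1 (mod 4)` (real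
periods) from the named fact `realPeriodRat_eq_unit_mul_plusPeriod`. The Literature proofs file
`SkinnerUrban2014/PAdicUnitImaginaryPeriodRatioProofs.lean` (x1b GEN 45) PROVES the IMAGINARY-period
sibling `imaginaryPeriodRat_eq_unit_mul_minusPeriod_of_mazur` (and its sibling file proves the plus
fact itself, `realPeriodRat_eq_unit_mul_plusPeriod_of_mazur`) from Mazur's `p ∤ c₀` — so here:
* §1 `periodRatio_of_periodFacts` — `hper` at every odd `p ≥ 5` from the plus comparison `hGV` and a
  minus comparison `hGVm` (displayed in the shape of the proofs file's conclusion);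
  **`periodRatio_of_mazur`** — `hper` at every odd `p ≥ 5` from `hM : mazur_not_dvd_maninConstant_of_odd`
  ALONE; `quadraticBranch_hdata_of_mazur` — VERBATIM the binder `hdata` of [124]/[126]/[128] and of
  cell bsd-cm's class node, from `hM`;
* §2 pair-level consumers with NO analytic datum and NO parity hypothesis:
  `bsdp_of_plusMC_of_pAdicGrossZagierValuation_of_readings_of_mazur`,
  `missingLowerBoundAt_of_plusMC_of_pAdicGrossZagierValuation_of_lowerReading_of_mazur`,
  `quadraticBranchRankOneLinkAt_of_pAdicGrossZagierValuation_of_readings_of_mazur`.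
NET for the ledgers (nothing booked; no mark / label / tier / count moves): for a rank-one `W` with a
good `a_p = 0` `p*`-twin `V`, `p ≥ 5` (ANY parity): `BSDp W p` ⟸ (C1_η)(V) [conjecture in print] ∧
C-cc-1(W, p) [EVIDENCE item] ∧ readings ((R2)|hKO, h74x; h74l for the lower half) ∧ NAMED FACTS
hmod / hGZ / hGZK / hPT / hnf / hM — no displayed analytic datum, no per-pair Manin datum, no table.
In particular the `j = 1728` (congruent-number) O10-PS pairs, all at `p ≡ 3 (mod 4)`, are covered by
the same sentence.

References (locators only): [Mazur1978] Cor. 4.1; [GreenbergVatsal2000] §3 Rem. 3.4;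
[EdixhovenManin1991] Prop. 2, §1; [Serre1972] §1.11 Prop. 12; [Kobayashi2003] Thm. 3.2 (p. 7), §4
(p. 8), Thm. 7.4 (p. 13); [KitajimaOtsuki2018] Main Thm. 1.3, Def. 2.1; [Miller2011LMS] §1, Def. 1.1.
-/

noncomputable section

open scoped Classical MatrixGroups ModularForm NumberField

open CongruenceSubgroup WeierstrassCurve Literature.NumberTheory.EllipticCurves
  Literature.NumberTheory.EllipticCurves.ModularForms
  Literature.NumberTheory.EllipticCurves.Kobayashi2003
  Literature.NumberTheory.EllipticCurves.Rank1Residual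
  Literature.NumberTheory.EllipticCurves.Rank1Residual.Typed
  Literature.NumberTheory.GaloisRepresentations
  Literature.NumberTheory.GaloisCohomology
  Literature.NumberTheory.EllipticCurves.IwasawaAlgebra

namespace Summit.BirchSwinnertonDyer.Rank1Residual.Additive

/-! ## §1 `hper` at every odd `p ≥ 5` -/

section PeriodRatio

variable (p : ℕ) [hp : Fact p.Prime]

/-- **`∃ ϖ ∈ ℚ`, `‖ϖ‖_p = 1`, `ϖ · |Ω⁻(V)| = Ω⁻_f` for every globally minimal `V/ℚ` with good
reduction at `p ≥ 5` and `a_p(V) = 0`**, GIVEN a minus-period comparison `hGVm` (the conclusion of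
`SkinnerUrban2014.imaginaryPeriodRat_eq_unit_mul_minusPeriod_of_mazur`, displayed): the
irreducibility hypothesis holds at an odd good supersingular prime (Serre 1972 §1.11 Prop. 12,
`hasIrreducibleModPGaloisRep_of_dvd_frobeniusTrace`), and `ϖ = u⁻¹`. CONDITIONAL on `hGVm`; nothing
booked. [cite: GreenbergVatsal2000, §3, Remark 3.4] [cite: Serre1972, §1.11 Prop. 12] -/
theorem exists_padicNorm_eq_one_mul_imaginaryPeriodRat_eq_minusPeriod_of_goodSupersingular
    (hGVm : ∀ (W : WeierstrassCurve ℚ) [W.IsElliptic] [W.IsGloballyMinimal] (p : ℕ) [Fact p.Prime],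
      5 ≤ p → W.HasGoodReductionAtPrime p → W.HasIrreducibleModPGaloisRep p →
      ∀ {N : ℕ} [NeZero N] (f : CuspForm (Gamma0 N) 2), IsNewformOf W f →
      ∃ u : ℚ, ‖(u : ℚ_[p])‖ = 1 ∧ W.imaginaryPeriodRat = u * minusPeriod f)
    (hp5 : 5 ≤ p) (V : WeierstrassCurve ℚ) [V.IsElliptic] [V.IsGloballyMinimal]
    {N : ℕ} [NeZero N] (f : CuspForm (Gamma0 N) 2) (hf : IsNewformOf V f)
    (hgood : V.HasGoodReductionAtPrime p) (hap : V.frobeniusTrace p = 0) :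
    ∃ ϖ : ℚ, ‖(ϖ : ℚ_[p])‖ = 1 ∧ (ϖ : ℝ) * V.imaginaryPeriodRat = minusPeriod f := by
  have hp2 : p ≠ 2 := by omega
  have hirr : V.HasIrreducibleModPGaloisRep p :=
    hasIrreducibleModPGaloisRep_of_dvd_frobeniusTrace V p hp2
      (V.not_dvd_minimalDiscriminantInt_of_hasGoodReductionAtPrime' p hgood)
      (by rw [hap]; exact dvd_zero _)
  obtain ⟨u, hu, hΩ⟩ := hGVm V p hp5 hgood hirr f hf
  have hu0 : u ≠ 0 := by
    rintro rfl
    rw [Rat.cast_zero, norm_zero] at hu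
    exact zero_ne_one hu
  refine ⟨u⁻¹, by rw [Rat.cast_inv, norm_inv, hu, inv_one], ?_⟩
  rw [hΩ, Rat.cast_inv, inv_mul_cancel_left₀ (Rat.cast_ne_zero.mpr hu0)]

/-- **The binder `hper` at EVERY odd `p ≥ 5`** from the plus comparison `hGV` (named fact
`realPeriodRat_eq_unit_mul_plusPeriod`) and a minus comparison `hGVm` (displayed): at
`p ≡ 1 (mod 4)` file 129's plus ratio, at `p ≡ 3 (mod 4)` the minus ratio. CONDITIONAL on `hGV`,
`hGVm`; nothing booked. [cite: GreenbergVatsal2000, §3, Remark 3.4] [cite: Serre1972, §1.11 Prop. 12] -/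
theorem periodRatio_of_periodFacts (hGV : realPeriodRat_eq_unit_mul_plusPeriod)
    (hGVm : ∀ (W : WeierstrassCurve ℚ) [W.IsElliptic] [W.IsGloballyMinimal] (p : ℕ) [Fact p.Prime],
      5 ≤ p → W.HasGoodReductionAtPrime p → W.HasIrreducibleModPGaloisRep p →
      ∀ {N : ℕ} [NeZero N] (f : CuspForm (Gamma0 N) 2), IsNewformOf W f →
      ∃ u : ℚ, ‖(u : ℚ_[p])‖ = 1 ∧ W.imaginaryPeriodRat = u * minusPeriod f)
    (hp5 : 5 ≤ p) :
    ∀ (V : WeierstrassCurve ℚ) [V.IsElliptic] [V.IsGloballyMinimal]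
      {N : ℕ} [NeZero N] (f : CuspForm (Gamma0 N) 2), IsNewformOf V f →
      V.HasGoodReductionAtPrime p → V.frobeniusTrace p = 0 →
      ∃ ϖ : ℚ, ‖(ϖ : ℚ_[p])‖ ≤ 1 ∧
        (if Even (p / 2) then (ϖ : ℝ) * V.realPeriodRat = plusPeriod f
          else (ϖ : ℝ) * V.imaginaryPeriodRat = minusPeriod f) := by
  intro V _ _ N _ f hf hgood hap
  by_cases heven : Even (p / 2)
  · exact periodRatio_of_realPeriodRat_eq_unit_mul_plusPeriod_of_even p hGV hp5 heven V f hf hgood hap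
  · obtain ⟨ϖ, hϖ, hrel⟩ :=
      exists_padicNorm_eq_one_mul_imaginaryPeriodRat_eq_minusPeriod_of_goodSupersingular p hGVm hp5 V
        f hf hgood hap
    exact ⟨ϖ, hϖ.le, by rw [if_neg heven]; exact hrel⟩

/-- **The binder `hper` at EVERY odd `p ≥ 5` from Mazur's `p ∤ c₀` ALONE** (`hM :
mazur_not_dvd_maninConstant_of_odd`, Invent. Math. 44 (1978) Cor. 4.1 in lattice form): both period
comparisons are THEOREMS granted `hM` (`SkinnerUrban2014.realPeriodRat_eq_unit_mul_plusPeriod_of_mazur`,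
`SkinnerUrban2014.imaginaryPeriodRat_eq_unit_mul_minusPeriod_of_mazur`). CONDITIONAL on `hM`; nothing
booked. [cite: Mazur1978, Cor. 4.1] [cite: GreenbergVatsal2000, §3, Remark 3.4] -/
theorem periodRatio_of_mazur (hM : mazur_not_dvd_maninConstant_of_odd) (hp5 : 5 ≤ p) :
    ∀ (V : WeierstrassCurve ℚ) [V.IsElliptic] [V.IsGloballyMinimal]
      {N : ℕ} [NeZero N] (f : CuspForm (Gamma0 N) 2), IsNewformOf V f →
      V.HasGoodReductionAtPrime p → V.frobeniusTrace p = 0 →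
      ∃ ϖ : ℚ, ‖(ϖ : ℚ_[p])‖ ≤ 1 ∧
        (if Even (p / 2) then (ϖ : ℝ) * V.realPeriodRat = plusPeriod f
          else (ϖ : ℝ) * V.imaginaryPeriodRat = minusPeriod f) :=
  periodRatio_of_periodFacts p (SkinnerUrban2014.realPeriodRat_eq_unit_mul_plusPeriod_of_mazur hM)
    (SkinnerUrban2014.imaginaryPeriodRat_eq_unit_mul_minusPeriod_of_mazur hM) hp5

/-- **The binder `hdata` of [124] / [126] / [128] and of the bsd-cm class node at EVERY odd `p ≥ 5`,
from Mazur's `p ∤ c₀` alone** (§1 ∘ `quadraticBranch_hdata_of_periodRatio`, Kobayashi Thm. 3.2 =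
Pollack). CONDITIONAL on `hM`; nothing booked. [cite: Mazur1978, Cor. 4.1]
[cite: Kobayashi2003, Thm. 3.2, (3.5) and (3.7) (p. 7)] [cite: Pollack2003, Thm. 5.6 and Prop. 6.18] -/
theorem quadraticBranch_hdata_of_mazur (hM : mazur_not_dvd_maninConstant_of_odd) (hp5 : 5 ≤ p) :
    ∀ (V : WeierstrassCurve ℚ) [V.IsElliptic] [V.IsGloballyMinimal]
      {N : ℕ} [NeZero N] (f : CuspForm (Gamma0 N) 2), IsNewformOf V f →
      V.HasGoodReductionAtPrime p → V.frobeniusTrace p = 0 →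
      ∃ ϖ : ℚ, (if Even (p / 2) then (ϖ : ℝ) * V.realPeriodRat = plusPeriod f
          else (ϖ : ℝ) * V.imaginaryPeriodRat = minusPeriod f) ∧
        ∃ L : IwasawaAlgebra p, IsQuadraticBranchMinusLFunction f p ϖ L :=
  quadraticBranch_hdata_of_periodRatio (by omega) (periodRatio_of_mazur p hM hp5)

end PeriodRatio

/-! ## §2 Pair-level consumers with NO analytic datum and NO parity hypothesis -/

namespace LevelBridge

variable (W : WeierstrassCurve ℚ) [W.IsElliptic] [W.IsGloballyMinimal] (p : ℕ) [hp : Fact p.Prime]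

/-- **Pair-level `BSD(W, p)` from (C1_η) ∧ C-cc-1 at EVERY odd `p ≥ 5`, NO analytic datum**: file
129's `…_of_periodRatio` with `hper` DISCHARGED by `periodRatio_of_mazur`. Inputs: (C1_η) at `V`,
C-cc-1 at `(W, p)`, named facts hmod/hGZ/hGZK/hPT/hnf/hM, reading (R2), exact odd-`η` reading `h74x`;
`W` of analytic rank one, `V` a globally minimal good `a_p = 0` model of `W^{(p*)}`. CONDITIONAL on
every displayed hypothesis; C-cc-1 and (C1_η) NOT claimed; nothing booked; O10 / O7-ss stay OPEN.
[cite: Mazur1978, Cor. 4.1] [cite: Kobayashi2003, Thm. 3.2 (p. 7), §4 (p. 8), Thm. 7.4 (p. 13)]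
[cite: KitajimaOtsuki2018, Main Thm. 1.3 (= Thm. 4.8) with Def. 2.1] [cite: Miller2011LMS, §1 and Def. 1.1] -/
theorem bsdp_of_plusMC_of_pAdicGrossZagierValuation_of_readings_of_mazur
    (hmod : hasEntireLFunction_rat) (hGZ : GrossZagier1986_thm_I_7_3)
    (hGZK : rank_eq_analyticRank_of_analyticRank_le_one)
    (hPT : poitouTate_selmerStructure_duality_real ℚ) (hnf : exists_isNewformOf)
    (hM : mazur_not_dvd_maninConstant_of_odd)
    (hR2 : OddBranchStrictMinusNoFiniteSubmoduleAt W p)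
    (h74x : ∀ (V : WeierstrassCurve ℚ) [V.IsElliptic] [V.IsGloballyMinimal] (C : VariableChange ℚ)
        {N : ℕ} [NeZero N] {f : CuspForm (Gamma0 N) 2},
        p ≠ 2 → C • W.quadraticTwist ((-1) ^ (p / 2) * p) = V →
        V.HasGoodReductionAtPrime p → V.frobeniusTrace p = 0 →
        QuadraticBranchPlusMainConjectureAt V p → IsNewformOf V f →
        ∀ (ϖ : ℚ), (if Even (p / 2) then (ϖ : ℝ) * V.realPeriodRat = plusPeriod f
            else (ϖ : ℝ) * V.imaginaryPeriodRat = minusPeriod f) →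
        ∀ (Lη : IwasawaAlgebra p), IsQuadraticBranchMinusLFunction f p ϖ Lη →
        ∀ (κ : ZpExtension ℚ p) (γ : Field.absoluteGaloisGroup ℚ),
          κ.IsCyclotomic → κ.IsTopGenerator γ → IsCyclotomicVariable p γ →
        ∀ (D : StrictSignedSelmerDualData W κ ℚ_[p] γ (-1)) (L' : IwasawaAlgebra p),
          Lη = PowerSeries.X * L' → D.charIdeal = Ideal.span {L'})
    (h2 : QuadraticBranchPAdicGrossZagierValuationAt W p)
    {V : WeierstrassCurve ℚ} [V.IsElliptic] [V.IsGloballyMinimal] {C : VariableChange ℚ}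
    (hp5 : 5 ≤ p) (hC : C • W.quadraticTwist ((-1) ^ (p / 2) * p) = V)
    (hgood : V.HasGoodReductionAtPrime p) (hap : V.frobeniusTrace p = 0)
    (h1 : QuadraticBranchPlusMainConjectureAt V p) (hr : W.analyticRank = 1) : BSDp W p :=
  bsdp_of_plusMC_of_pAdicGrossZagierValuation_of_readings_of_periodRatio W p hmod hGZ hGZK hPT hnf
    (periodRatio_of_mazur p hM hp5) hR2 h74x h2 hp5 hC hgood hap h1 hr

/-- **Pair-level LOWER half `MissingLowerBoundAt W p` at EVERY odd `p ≥ 5`, NO analytic datum, NO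
Kitajima–Otsuki input**: file 129's `…_of_lowerReading_of_periodRatio` with `hper` DISCHARGED by
`periodRatio_of_mazur`. CONDITIONAL on every displayed hypothesis; nothing booked; O10 / O7-ss stay
OPEN. [cite: Mazur1978, Cor. 4.1] [cite: Kobayashi2003, Thm. 3.2 (p. 7), §4 (p. 8), Thm. 7.4 (p. 13)]
[cite: Miller2011LMS, §1 and Def. 1.1] -/
theorem missingLowerBoundAt_of_plusMC_of_pAdicGrossZagierValuation_of_lowerReading_of_mazur
    (hmod : hasEntireLFunction_rat) (hGZ : GrossZagier1986_thm_I_7_3)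
    (hGZK : rank_eq_analyticRank_of_analyticRank_le_one)
    (hPT : poitouTate_selmerStructure_duality_real ℚ) (hnf : exists_isNewformOf)
    (hM : mazur_not_dvd_maninConstant_of_odd)
    (h74l : ∀ (V : WeierstrassCurve ℚ) [V.IsElliptic] [V.IsGloballyMinimal] (C : VariableChange ℚ)
        {N : ℕ} [NeZero N] {f : CuspForm (Gamma0 N) 2},
        p ≠ 2 → C • W.quadraticTwist ((-1) ^ (p / 2) * p) = V →
        V.HasGoodReductionAtPrime p → V.frobeniusTrace p = 0 →
        QuadraticBranchPlusMainConjectureAt V p → IsNewformOf V f →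
        ∀ (ϖ : ℚ), (if Even (p / 2) then (ϖ : ℝ) * V.realPeriodRat = plusPeriod f
            else (ϖ : ℝ) * V.imaginaryPeriodRat = minusPeriod f) →
        ∀ (Lη : IwasawaAlgebra p), IsQuadraticBranchMinusLFunction f p ϖ Lη →
        ∀ (κ : ZpExtension ℚ p) (γ : Field.absoluteGaloisGroup ℚ),
          κ.IsCyclotomic → κ.IsTopGenerator γ → IsCyclotomicVariable p γ →
        ∀ (D : StrictSignedSelmerDualData W κ ℚ_[p] γ (-1)) (L' : IwasawaAlgebra p),
          Lη = PowerSeries.X * L' → D.charIdeal ≤ Ideal.span {L'})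
    (h2 : QuadraticBranchPAdicGrossZagierValuationAt W p)
    {V : WeierstrassCurve ℚ} [V.IsElliptic] [V.IsGloballyMinimal] {C : VariableChange ℚ}
    (hp5 : 5 ≤ p) (hC : C • W.quadraticTwist ((-1) ^ (p / 2) * p) = V)
    (hgood : V.HasGoodReductionAtPrime p) (hap : V.frobeniusTrace p = 0)
    (h1 : QuadraticBranchPlusMainConjectureAt V p) (hr : W.analyticRank = 1) :
    MissingLowerBoundAt W p :=
  missingLowerBoundAt_of_plusMC_of_pAdicGrossZagierValuation_of_lowerReading_of_periodRatio W p hmod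
    hGZ hGZK hPT hnf (periodRatio_of_mazur p hM hp5) h74l h2 hp5 hC hgood hap h1 hr

/-- **(C2_η) `QuadraticBranchRankOneLinkAt W p` at EVERY odd `p ≥ 5`, NO analytic datum**: [128]'s
`…_of_readings_of_periodRatio` with `hper` DISCHARGED by `periodRatio_of_mazur`. CONDITIONAL on
every displayed hypothesis; C-cc-1 NOT claimed; nothing booked. [cite: Mazur1978, Cor. 4.1]
[cite: BurungaleKobayashiOta2023, App. A Cor. A.5 (shape only)] [cite: Kobayashi2003, §4 (p. 8), Thm. 7.4 (p. 13)] -/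
theorem quadraticBranchRankOneLinkAt_of_pAdicGrossZagierValuation_of_readings_of_mazur
    (hmod : hasEntireLFunction_rat) (hGZ : GrossZagier1986_thm_I_7_3)
    (hGZK : rank_eq_analyticRank_of_analyticRank_le_one)
    (hPT : poitouTate_selmerStructure_duality_real ℚ) (hnf : exists_isNewformOf)
    (hM : mazur_not_dvd_maninConstant_of_odd)
    (hR2 : OddBranchStrictMinusNoFiniteSubmoduleAt W p)
    (h74x : ∀ (V : WeierstrassCurve ℚ) [V.IsElliptic] [V.IsGloballyMinimal] (C : VariableChange ℚ)
        {N : ℕ} [NeZero N] {f : CuspForm (Gamma0 N) 2},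
        p ≠ 2 → C • W.quadraticTwist ((-1) ^ (p / 2) * p) = V →
        V.HasGoodReductionAtPrime p → V.frobeniusTrace p = 0 →
        QuadraticBranchPlusMainConjectureAt V p → IsNewformOf V f →
        ∀ (ϖ : ℚ), (if Even (p / 2) then (ϖ : ℝ) * V.realPeriodRat = plusPeriod f
            else (ϖ : ℝ) * V.imaginaryPeriodRat = minusPeriod f) →
        ∀ (Lη : IwasawaAlgebra p), IsQuadraticBranchMinusLFunction f p ϖ Lη →
        ∀ (κ : ZpExtension ℚ p) (γ : Field.absoluteGaloisGroup ℚ),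
          κ.IsCyclotomic → κ.IsTopGenerator γ → IsCyclotomicVariable p γ →
        ∀ (D : StrictSignedSelmerDualData W κ ℚ_[p] γ (-1)) (L' : IwasawaAlgebra p),
          Lη = PowerSeries.X * L' → D.charIdeal = Ideal.span {L'})
    (h2 : QuadraticBranchPAdicGrossZagierValuationAt W p) (hp5 : 5 ≤ p) :
    QuadraticBranchRankOneLinkAt W p :=
  quadraticBranchRankOneLinkAt_of_pAdicGrossZagierValuation_of_readings_of_periodRatio W p hmod hGZ
    hGZK hPT hnf (periodRatio_of_mazur p hM hp5) hR2 h74x h2 hp5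

end LevelBridge

end Summit.BirchSwinnertonDyer.Rank1Residual.Additive

end
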